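import Summits.QuantumFields.YangMills.Theorems.UnitScaleTiltBlockAvgCorrector
import Literature.MathematicalPhysics.QuantumFieldTheory.Balaban1983to89.BlockAveragingEMLAnalyticMean
import HarnessLib

/-!
# Route `UnitScaleTilt`, crux K1 child «MinimiserStabilityRegPr» (stmt-QuantumFields-19200), registered stub `stub_prop8` (v5 98cb23610ad721f5; leaf V2
# «[Balaban1985Variational] Prop. 8 at the d = 3 carriers») — sub-lemma V2-EL, part 4: THE DIFFERENTIABLE STRUCTURE OF THE ONE-STEP FIBRE IN THE
# CENTRAL-BOND COORDINATE — (§1) parallel transports along bondwise differentiable families of `SU(2)` fields are differentiable; (§2) the guarded fibre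
# map of Bałaban's (0.4) block averaging in the private `W`-coordinate of a coarse bond (`BlockAveragingEMLHaarAC.fibreMap`: `W ↦ eml(1 | h_iW^*)·W`),
# extended to all of `M₂(ℂ)` and to a differentiable one-parameter family of off-central data `h_i(t)`, is Fréchet differentiable jointly in `(W, t)`;
# its partial derivative in `W` is the explicit line derivative `A₁X = D eml(T₀)[(0 | h_iX^*)]·W₀ + eml(T₀)·X`, which is within `148·‖T₀ − 1‖·‖X‖` of
# the invertible map `X ↦ X + θ·W₀X^*W₀` (`θ = #{off-central}/|I| < 1`) — so it has a bounded left inverse as soon as the (0.4) loop variables at the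
# bond are within `~|I|⁻¹/300` of the identity

Cell `ym3-torus` ∕ fleet seat `ym-ust-19200-p2` (HUMAN RULING D-0037, YM ladder rung R3), successor g3.  WHERE THIS SITS.  Parts 1–3 reduced the Euler–Lagrange
equation of an R2-critical configuration to the existence of DIFFERENTIABLE curves inside the one-step fibre with prescribed off-central velocity.  The exact
corrector (`BlockAvgCorrector.exists_avgFun_eq_of_near`, p448916) produces fibre points by re-solving, coarse bond by coarse bond, the guarded fibre equation
`eml(1 | h_iW^*)·W = V(c)` for the central coordinate `W` (a Banach fixed point, Lipschitz in the data).  Differentiability of the re-solved `W(t)` along a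
differentiable family of data is the implicit-function statement of part 3 (`hasDerivAt_of_implicit_of_lipschitz`), whose two analytic inputs are supplied
here: joint differentiability of the fibre map (from the analyticity of the exp-mean-log, `ExpMeanLog.analyticAt_eml`) and a bounded left inverse of its
`W`-derivative (from the near-identity calculus of analytic means, `BlockAveragingEMLAnalyticMean.norm_fderiv_eml_sub_mean_le` ∕ `norm_eml_one_add_sub_sub_mean_le`,
and finite-dimensional linear algebra).  Part 5 assembles the curves and the Euler–Lagrange equation in multiplier form.

WHAT IS PROVED (sorry-free, no definition; [folklore] throughout — elementary calculus over the tree's (0.4) vocabulary):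
* §1 **`differentiableAt_coe_holAt`**;
* §2 `tuple_line`, **`hasDerivAt_fibreCore_line`**, `norm_tupleDir_le`, **`norm_fibreCoreDeriv_sub_le`** (the `148‖T₀ − 1‖` estimate), **`differentiableAt_fibreCore_param`**,
  `differentiableAt_fibreCore`, **`fderiv_fibreCore_param_inl`** (partial derivative = line derivative), **`exists_leftInverse_of_bound`**.

References: T. Bałaban, CMP 109 (1987) 249–301 [Balaban1987RG1] ((0.4) p.253); CMP 102 (1985) 277–309 [Balaban1985Variational] ((127) p.297).
-/

noncomputable section

open scoped BigOperators Matrix.Norms.L2Operator Matrix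
open Filter Topology Asymptotics NormedSpace

namespace Summit.QuantumFields.YangMills.Theorems.Prop8Criticality

open Literature.MathematicalPhysics.QuantumFieldTheory.Balaban1983to89
open T4Continuum

variable {P : Params} {j : ℕ}

/-! ## §1 Differentiability of parallel transports along bondwise differentiable families -/

section Transport

/-- **PARALLEL TRANSPORT ALONG A BONDWISE DIFFERENTIABLE FAMILY IS DIFFERENTIABLE**: if every bond coordinate `t ↦ Γ(t)(b) ∈ M₂(ℂ)` is differentiable
at `t₀`, so is `t ↦ 𝒰(γ)(Γ(t))` for every sequence of oriented steps `γ` (product rule along the walk; inverses are adjoints). [folklore] -/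
theorem differentiableAt_coe_holAt {Γ : ℝ → GaugeField P j (Matrix.specialUnitaryGroup (Fin 2) ℂ)} {t₀ : ℝ}
    (hΓ : ∀ b : PBond P j, DifferentiableAt ℝ (fun t : ℝ => (Γ t b : Matrix (Fin 2) (Fin 2) ℂ)) t₀) :
    ∀ γ : List (LStep P j), DifferentiableAt ℝ (fun t : ℝ => ((holAt (Γ t) γ : Matrix.specialUnitaryGroup (Fin 2) ℂ) : Matrix (Fin 2) (Fin 2) ℂ)) t₀
  | [] => by
    simp only [holAt_nil]
    exact differentiableAt_const _
  | s :: γ => by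
    simp only [holAt_cons, Submonoid.coe_mul]
    refine DifferentiableAt.mul ?_ (differentiableAt_coe_holAt hΓ γ)
    cases hs : s.fwd
    · simp only [Bool.false_eq_true, ↓reduceIte]
      -- the inverse in `SU(2)` read in `M₂(ℂ)` is the adjoint (definitionally)
      change DifferentiableAt ℝ (fun t : ℝ => star ((Γ t s.bond : Matrix.specialUnitaryGroup (Fin 2) ℂ) : Matrix (Fin 2) (Fin 2) ℂ)) t₀
      exact (hΓ s.bond).star
    · simp only [↓reduceIte]
      exact hΓ s.bond

end Transport

/-! ## §2 The guarded fibre map in the W-coordinate, extended to `M₂(ℂ)`: differentiability, its derivative along lines, and the near-identity estimate -/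

section FibreCore

open ExpMeanLog B7TransferAnalyticMean BlockAveragingEMLAnalyticMean

variable {ι : Type*} [Fintype ι] (cen : ι → Prop) [DecidablePred cen]

omit [Fintype ι] in
/-- The W-coordinate tuple `T_h(W) = (1 at central indices, h_i·W^* off them)` of the guarded fibre map ([Balaban1987RG1] (0.4) in the private
coordinate, `BlockAveragingEMLHaarAC.fibreFamily` read in `M₂(ℂ)` and extended to all matrices `W`) is affine in `W`: along a line,
`T_h(W₀ + sX) = T_h(W₀) + s·(0 | h_i X^*)`. [folklore] -/
theorem tuple_line (h : ι → Matrix (Fin 2) (Fin 2) ℂ) (W₀ X : Matrix (Fin 2) (Fin 2) ℂ) (s : ℝ) :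
    (fun i => if cen i then (1 : Matrix (Fin 2) (Fin 2) ℂ) else h i * star (W₀ + (s : ℂ) • X))
      = (fun i => if cen i then (1 : Matrix (Fin 2) (Fin 2) ℂ) else h i * star W₀)
          + (s : ℂ) • (fun i => if cen i then (0 : Matrix (Fin 2) (Fin 2) ℂ) else h i * star X) := by
  funext i
  simp only [Pi.add_apply, Pi.smul_apply]
  split_ifs with hc
  · rw [smul_zero, add_zero]
  · rw [star_add, star_smul, Complex.star_def, Complex.conj_ofReal, mul_add, mul_smul_comm]

/-- **THE DERIVATIVE OF THE EXTENDED FIBRE MAP ALONG A LINE**: for `K_h(W) = eml(T_h(W))·W` and `T_h(W₀)` inside the polydisc of `eml`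
(`‖T_h(W₀) − 1‖ < 1/3`), `s ↦ K_h(W₀ + sX)` has derivative `D eml(T_h W₀)[(0 | h_i X^*)]·W₀ + eml(T_h W₀)·X` at `s = 0`. [folklore] -/
theorem hasDerivAt_fibreCore_line (h : ι → Matrix (Fin 2) (Fin 2) ℂ) (W₀ X : Matrix (Fin 2) (Fin 2) ℂ)
    (hT₀ : ‖(fun i => if cen i then (1 : Matrix (Fin 2) (Fin 2) ℂ) else h i * star W₀) - 1‖ < 1 / 3) :
    HasDerivAt (fun s : ℝ => eml (fun i => if cen i then (1 : Matrix (Fin 2) (Fin 2) ℂ) else h i * star (W₀ + (s : ℂ) • X)) * (W₀ + (s : ℂ) • X))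
      (fderiv ℂ (eml : (ι → Matrix (Fin 2) (Fin 2) ℂ) → Matrix (Fin 2) (Fin 2) ℂ) (fun i => if cen i then (1 : Matrix (Fin 2) (Fin 2) ℂ) else h i * star W₀)
          (fun i => if cen i then (0 : Matrix (Fin 2) (Fin 2) ℂ) else h i * star X) * W₀
        + eml (fun i => if cen i then (1 : Matrix (Fin 2) (Fin 2) ℂ) else h i * star W₀) * X) 0 := by
  set T₀ : ι → Matrix (Fin 2) (Fin 2) ℂ := fun i => if cen i then (1 : Matrix (Fin 2) (Fin 2) ℂ) else h i * star W₀ with hT₀def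
  set L : ι → Matrix (Fin 2) (Fin 2) ℂ := fun i => if cen i then (0 : Matrix (Fin 2) (Fin 2) ℂ) else h i * star X with hLdef
  -- `eml` is differentiable at `T₀`
  have hballi : ∀ i, ‖T₀ i - 1‖ < 1 := fun i => by
    have := (norm_le_pi_norm (T₀ - 1) i).trans_lt hT₀
    rw [Pi.sub_apply, Pi.one_apply] at this
    linarith
  have heml : HasFDerivAt (eml : (ι → Matrix (Fin 2) (Fin 2) ℂ) → Matrix (Fin 2) (Fin 2) ℂ)
      (fderiv ℂ (eml : (ι → Matrix (Fin 2) (Fin 2) ℂ) → Matrix (Fin 2) (Fin 2) ℂ) T₀) T₀ :=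
    (analyticAt_eml hballi).differentiableAt.hasFDerivAt
  -- the tuple along the line
  have hline : HasDerivAt (fun s : ℝ => T₀ + (s : ℂ) • L) L 0 := by
    have h1 : HasDerivAt (fun s : ℝ => (s : ℂ) • L) L 0 := by
      have := (hasDerivAt_id (0 : ℝ)).ofReal_comp.smul_const L
      simpa using this
    simpa using h1.const_add T₀
  have hcomp : HasDerivAt (fun s : ℝ => eml (T₀ + (s : ℂ) • L))
      (fderiv ℂ (eml : (ι → Matrix (Fin 2) (Fin 2) ℂ) → Matrix (Fin 2) (Fin 2) ℂ) T₀ L) 0 := by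
    have h0 : T₀ = T₀ + ((0 : ℝ) : ℂ) • L := by simp
    have := (heml.restrictScalars ℝ).comp_hasDerivAt_of_eq (0 : ℝ) hline h0
    simpa [Function.comp_def] using this
  have hcomp' : HasDerivAt (fun s : ℝ => eml (fun i => if cen i then (1 : Matrix (Fin 2) (Fin 2) ℂ) else h i * star (W₀ + (s : ℂ) • X)))
      (fderiv ℂ (eml : (ι → Matrix (Fin 2) (Fin 2) ℂ) → Matrix (Fin 2) (Fin 2) ℂ) T₀ L) 0 := by
    refine hcomp.congr_of_eventuallyEq ?_
    filter_upwards with s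
    rw [tuple_line cen h W₀ X s]
  -- the second factor along the line
  have hW : HasDerivAt (fun s : ℝ => W₀ + (s : ℂ) • X) X 0 := by
    have h1 : HasDerivAt (fun s : ℝ => (s : ℂ) • X) X 0 := by
      have := (hasDerivAt_id (0 : ℝ)).ofReal_comp.smul_const X
      simpa using this
    simpa using h1.const_add W₀
  have hprod := hcomp'.mul hW
  simp only [Complex.ofReal_zero, zero_smul, add_zero] at hprod
  exact hprod

/-- The off-central tuple `(0 | h_i X^*)` is bounded by `‖X‖` in the sup norm when the `h_i` are unitary. [folklore] -/
theorem norm_tupleDir_le (h : ι → Matrix (Fin 2) (Fin 2) ℂ) (hh : ∀ i, ¬ cen i → h i ∈ Matrix.unitaryGroup (Fin 2) ℂ) (X : Matrix (Fin 2) (Fin 2) ℂ) :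
    ‖(fun i => if cen i then (0 : Matrix (Fin 2) (Fin 2) ℂ) else h i * star X)‖ ≤ ‖X‖ := by
  refine (pi_norm_le_iff_of_nonneg (norm_nonneg X)).mpr fun i => ?_
  split_ifs with hc
  · rw [norm_zero]; exact norm_nonneg X
  · calc ‖h i * star X‖ ≤ ‖h i‖ * ‖star X‖ := norm_mul_le _ _
      _ = ‖X‖ := by rw [UnitaryModel.norm_of_mem_unitaryGroup (hh i hc), one_mul, norm_star]

/-- **THE NEAR-IDENTITY ESTIMATE FOR THE DERIVATIVE OF THE FIBRE MAP IN THE CENTRAL COORDINATE**: with `T₀ = T_h(W₀)` within `v ≤ 1/24` of the identity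
tuple (the (0.4) loop variables at `c` within `v` of `1`), `W₀` and the off-central `h_i` unitary, and `θ = #{off-central}/|I|`, the line derivative
`A₁X = D eml(T₀)[(0 | h_iX^*)]·W₀ + eml(T₀)·X` satisfies `‖A₁X − (X + θ·W₀X^*W₀)‖ ≤ 148·v·‖X‖` — the derivative of the exp-mean-log at a near-identity
tuple is the arithmetic mean up to `144‖T₀ − 1‖` (`norm_fderiv_eml_sub_mean_le`) and `eml(T₀) = 1 + O(‖T₀ − 1‖)`. [folklore] -/
theorem norm_fibreCoreDeriv_sub_le (h : ι → Matrix (Fin 2) (Fin 2) ℂ) (hh : ∀ i, ¬ cen i → h i ∈ Matrix.unitaryGroup (Fin 2) ℂ)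
    {W₀ : Matrix (Fin 2) (Fin 2) ℂ} (hW₀ : W₀ ∈ Matrix.unitaryGroup (Fin 2) ℂ) (X : Matrix (Fin 2) (Fin 2) ℂ) {v : ℝ}
    (hv : ‖(fun i => if cen i then (1 : Matrix (Fin 2) (Fin 2) ℂ) else h i * star W₀) - 1‖ ≤ v) (hv24 : v ≤ 1 / 24) :
    ‖fderiv ℂ (eml : (ι → Matrix (Fin 2) (Fin 2) ℂ) → Matrix (Fin 2) (Fin 2) ℂ) (fun i => if cen i then (1 : Matrix (Fin 2) (Fin 2) ℂ) else h i * star W₀)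
          (fun i => if cen i then (0 : Matrix (Fin 2) (Fin 2) ℂ) else h i * star X) * W₀
        + eml (fun i => if cen i then (1 : Matrix (Fin 2) (Fin 2) ℂ) else h i * star W₀) * X
        - (X + ((((Finset.univ.filter fun i => ¬ cen i).card : ℝ) : ℂ) / ((Fintype.card ι : ℝ) : ℂ)) • (W₀ * star X * W₀))‖
      ≤ 148 * v * ‖X‖ := by
  set T₀ : ι → Matrix (Fin 2) (Fin 2) ℂ := fun i => if cen i then (1 : Matrix (Fin 2) (Fin 2) ℂ) else h i * star W₀ with hT₀def
  set L : ι → Matrix (Fin 2) (Fin 2) ℂ := fun i => if cen i then (0 : Matrix (Fin 2) (Fin 2) ℂ) else h i * star X with hLdef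
  set m : ℕ := (Finset.univ.filter fun i => ¬ cen i).card with hm
  set n : ℕ := Fintype.card ι with hn
  have hv0 : 0 ≤ v := (norm_nonneg _).trans hv
  have hX0 : 0 ≤ ‖X‖ := norm_nonneg _
  have hW₀1 : ‖W₀‖ = 1 := UnitaryModel.norm_of_mem_unitaryGroup hW₀
  have hW₀W : star W₀ * W₀ = 1 := Matrix.mem_unitaryGroup_iff'.mp hW₀
  have hLX : ‖L‖ ≤ ‖X‖ := norm_tupleDir_le cen h hh X
  -- (p1) the derivative of `eml` at `T₀` is the mean up to `144 v`
  have p1 : ‖fderiv ℂ (eml : (ι → Matrix (Fin 2) (Fin 2) ℂ) → Matrix (Fin 2) (Fin 2) ℂ) T₀ L - meanCLM ι (Matrix (Fin 2) (Fin 2) ℂ) L‖ ≤ 144 * v * ‖X‖ := by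
    have := norm_fderiv_eml_sub_mean_le (U := T₀) (hv.trans hv24) L
    calc _ ≤ 144 * ‖L‖ * ‖T₀ - 1‖ := this
      _ ≤ 144 * ‖X‖ * v := by gcongr
      _ = 144 * v * ‖X‖ := by ring
  -- (p2) the mean of `(0 | h_iX^*)` is `θ·W₀X^*` up to `v`
  have hTi : ∀ i, ‖T₀ i - 1‖ ≤ v := fun i => by
    have := norm_le_pi_norm (T₀ - 1) i
    rw [Pi.sub_apply, Pi.one_apply] at this
    exact this.trans hv
  have hhi : ∀ i, ¬ cen i → h i = T₀ i * W₀ := fun i hc => by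
    simp only [hT₀def, hc, ↓reduceIte]; rw [mul_assoc, hW₀W, mul_one]
  have hsum : ∑ i, L i = (m : ℂ) • (W₀ * star X) + ∑ i ∈ Finset.univ.filter (fun i => ¬ cen i), (T₀ i - 1) * (W₀ * star X) := by
    have h1 : ∑ i, L i = ∑ i ∈ Finset.univ.filter (fun i => ¬ cen i), h i * star X := by
      rw [Finset.sum_filter]
      refine Finset.sum_congr rfl fun i _ => ?_
      simp only [hLdef]
      split_ifs with hc <;> simp
    rw [h1]
    have h2 : ∀ i ∈ Finset.univ.filter (fun i => ¬ cen i), h i * star X = W₀ * star X + (T₀ i - 1) * (W₀ * star X) := by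
      intro i hi
      rw [Finset.mem_filter] at hi
      rw [hhi i hi.2]; noncomm_ring
    rw [Finset.sum_congr rfl h2, Finset.sum_add_distrib, Finset.sum_const, ← hm, ← Nat.cast_smul_eq_nsmul ℂ]
  have p2 : ‖meanCLM ι (Matrix (Fin 2) (Fin 2) ℂ) L - (((m : ℝ) : ℂ) / ((n : ℝ) : ℂ)) • (W₀ * star X)‖ ≤ v * ‖X‖ := by
    rw [meanCLM_apply, hsum, smul_add, smul_smul, ← hn]
    have hcoef : ((n : ℂ))⁻¹ * (m : ℂ) = ((m : ℝ) : ℂ) / ((n : ℝ) : ℂ) := by push_cast; ring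
    rw [hcoef, add_sub_cancel_left, norm_smul, norm_inv, Complex.norm_natCast]
    -- the error sum
    have hterm : ∀ i ∈ Finset.univ.filter (fun i => ¬ cen i), ‖(T₀ i - 1) * (W₀ * star X)‖ ≤ v * ‖X‖ := by
      intro i _
      calc ‖(T₀ i - 1) * (W₀ * star X)‖ ≤ ‖T₀ i - 1‖ * (‖W₀‖ * ‖star X‖) := (norm_mul_le _ _).trans (mul_le_mul_of_nonneg_left (norm_mul_le _ _) (norm_nonneg _))
        _ ≤ v * (1 * ‖X‖) := by rw [hW₀1, norm_star]; exact mul_le_mul_of_nonneg_right (hTi i) (by positivity)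
        _ = v * ‖X‖ := by ring
    have hsumle : ‖∑ i ∈ Finset.univ.filter (fun i => ¬ cen i), (T₀ i - 1) * (W₀ * star X)‖ ≤ m * (v * ‖X‖) := by
      refine (norm_sum_le _ _).trans ?_
      calc ∑ i ∈ Finset.univ.filter (fun i => ¬ cen i), ‖(T₀ i - 1) * (W₀ * star X)‖
            ≤ ∑ _i ∈ Finset.univ.filter (fun i => ¬ cen i), v * ‖X‖ := Finset.sum_le_sum hterm
        _ = m * (v * ‖X‖) := by rw [Finset.sum_const, nsmul_eq_mul, hm]
    have hmn : (m : ℝ) ≤ n := by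
      rw [hm, hn]; exact_mod_cast Finset.card_filter_le _ _
    rcases Nat.eq_zero_or_pos n with hn0 | hnpos
    · rw [hn0]; simp only [Nat.cast_zero, inv_zero, zero_mul]; positivity
    · have hn' : (0 : ℝ) < n := by exact_mod_cast hnpos
      calc (n : ℝ)⁻¹ * ‖∑ i ∈ Finset.univ.filter (fun i => ¬ cen i), (T₀ i - 1) * (W₀ * star X)‖ ≤ (n : ℝ)⁻¹ * (m * (v * ‖X‖)) :=
            mul_le_mul_of_nonneg_left hsumle (by positivity)
        _ ≤ (n : ℝ)⁻¹ * (n * (v * ‖X‖)) := by gcongr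
        _ = v * ‖X‖ := by field_simp
  -- (p3) `eml(T₀) = 1 + O(v)`
  have p3 : ‖eml T₀ - 1‖ ≤ (5 / 2) * v := by
    have hV : ‖T₀ - 1‖ ≤ 1 / 12 := hv.trans (hv24.trans (by norm_num))
    have h1 := norm_eml_one_add_sub_sub_mean_le (V := T₀ - 1) hV
    rw [add_sub_cancel] at h1
    have h2 := norm_meanCLM_apply_le (ι := ι) (𝔄 := Matrix (Fin 2) (Fin 2) ℂ) (T₀ - 1)
    have h3 : ‖eml T₀ - 1‖ ≤ ‖eml T₀ - 1 - meanCLM ι (Matrix (Fin 2) (Fin 2) ℂ) (T₀ - 1)‖ + ‖meanCLM ι (Matrix (Fin 2) (Fin 2) ℂ) (T₀ - 1)‖ := by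
      have := norm_add_le (eml T₀ - 1 - meanCLM ι (Matrix (Fin 2) (Fin 2) ℂ) (T₀ - 1)) (meanCLM ι (Matrix (Fin 2) (Fin 2) ℂ) (T₀ - 1))
      rwa [sub_add_cancel] at this
    have h4 : ‖T₀ - 1‖ ^ 2 ≤ v * (1 / 24) := by
      rw [sq]; exact mul_le_mul hv ((hv.trans hv24)) (norm_nonneg _) hv0
    nlinarith [h1, h2, h3, h4, hv, norm_nonneg (T₀ - 1)]
  -- assemble
  have hdecomp : fderiv ℂ (eml : (ι → Matrix (Fin 2) (Fin 2) ℂ) → Matrix (Fin 2) (Fin 2) ℂ) T₀ L * W₀ + eml T₀ * X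
        - (X + (((m : ℝ) : ℂ) / ((n : ℝ) : ℂ)) • (W₀ * star X * W₀))
      = (fderiv ℂ (eml : (ι → Matrix (Fin 2) (Fin 2) ℂ) → Matrix (Fin 2) (Fin 2) ℂ) T₀ L - meanCLM ι (Matrix (Fin 2) (Fin 2) ℂ) L) * W₀
        + (meanCLM ι (Matrix (Fin 2) (Fin 2) ℂ) L - (((m : ℝ) : ℂ) / ((n : ℝ) : ℂ)) • (W₀ * star X)) * W₀
        + (eml T₀ - 1) * X := by
    rw [sub_mul, sub_mul, smul_mul_assoc, sub_mul, one_mul]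
    abel
  have hcast : ((((Finset.univ.filter fun i => ¬ cen i).card : ℝ) : ℂ) / ((Fintype.card ι : ℝ) : ℂ)) = ((m : ℝ) : ℂ) / ((n : ℝ) : ℂ) := by
    rw [hm, hn]
  rw [hcast, hdecomp]
  have n1 : ‖(fderiv ℂ (eml : (ι → Matrix (Fin 2) (Fin 2) ℂ) → Matrix (Fin 2) (Fin 2) ℂ) T₀ L - meanCLM ι (Matrix (Fin 2) (Fin 2) ℂ) L) * W₀‖ ≤ 144 * v * ‖X‖ :=
    (norm_mul_le _ _).trans (by rw [hW₀1, mul_one]; exact p1)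
  have n2 : ‖(meanCLM ι (Matrix (Fin 2) (Fin 2) ℂ) L - (((m : ℝ) : ℂ) / ((n : ℝ) : ℂ)) • (W₀ * star X)) * W₀‖ ≤ v * ‖X‖ :=
    (norm_mul_le _ _).trans (by rw [hW₀1, mul_one]; exact p2)
  have n3 : ‖(eml T₀ - 1) * X‖ ≤ (5 / 2) * v * ‖X‖ := (norm_mul_le _ _).trans (mul_le_mul_of_nonneg_right p3 hX0)
  calc _ ≤ ‖(fderiv ℂ (eml : (ι → Matrix (Fin 2) (Fin 2) ℂ) → Matrix (Fin 2) (Fin 2) ℂ) T₀ L - meanCLM ι (Matrix (Fin 2) (Fin 2) ℂ) L) * W₀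
          + (meanCLM ι (Matrix (Fin 2) (Fin 2) ℂ) L - (((m : ℝ) : ℂ) / ((n : ℝ) : ℂ)) • (W₀ * star X)) * W₀‖ + ‖(eml T₀ - 1) * X‖ := norm_add_le _ _
    _ ≤ (‖(fderiv ℂ (eml : (ι → Matrix (Fin 2) (Fin 2) ℂ) → Matrix (Fin 2) (Fin 2) ℂ) T₀ L - meanCLM ι (Matrix (Fin 2) (Fin 2) ℂ) L) * W₀‖
          + ‖(meanCLM ι (Matrix (Fin 2) (Fin 2) ℂ) L - (((m : ℝ) : ℂ) / ((n : ℝ) : ℂ)) • (W₀ * star X)) * W₀‖) + ‖(eml T₀ - 1) * X‖ := by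
        gcongr; exact norm_add_le _ _
    _ ≤ (144 * v * ‖X‖ + v * ‖X‖) + (5 / 2) * v * ‖X‖ := by gcongr
    _ ≤ 148 * v * ‖X‖ := by nlinarith

/-- **DIFFERENTIABILITY OF THE EXTENDED FIBRE MAP, JOINTLY IN THE COORDINATE AND A PARAMETER**: if the off-central data `t ↦ h_i(t)` are differentiable at
`t = 0` and `T_{h(0)}(W₀)` lies in the unit polydisc of `eml`, then `(W, t) ↦ eml(T_{h(t)}(W))·W` is (real) Fréchet differentiable at `(W₀, 0)`. [folklore] -/
theorem differentiableAt_fibreCore_param (h : ℝ → ι → Matrix (Fin 2) (Fin 2) ℂ) (W₀ : Matrix (Fin 2) (Fin 2) ℂ)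
    (hh : ∀ i, DifferentiableAt ℝ (fun t : ℝ => h t i) 0)
    (hT₀ : ∀ i, ‖(if cen i then (1 : Matrix (Fin 2) (Fin 2) ℂ) else h 0 i * star W₀) - 1‖ < 1) :
    DifferentiableAt ℝ (fun p : Matrix (Fin 2) (Fin 2) ℂ × ℝ =>
      eml (fun i => if cen i then (1 : Matrix (Fin 2) (Fin 2) ℂ) else h p.2 i * star p.1) * p.1) (W₀, 0) := by
  have hT : DifferentiableAt ℝ (fun p : Matrix (Fin 2) (Fin 2) ℂ × ℝ =>
      (fun i => if cen i then (1 : Matrix (Fin 2) (Fin 2) ℂ) else h p.2 i * star p.1)) (W₀, 0) := by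
    refine differentiableAt_pi.mpr fun i => ?_
    split_ifs with hc
    · exact differentiableAt_const _
    · refine DifferentiableAt.mul ?_ differentiableAt_fst.star
      have hsnd : DifferentiableAt ℝ (fun p : Matrix (Fin 2) (Fin 2) ℂ × ℝ => p.2) (W₀, (0 : ℝ)) := differentiableAt_snd
      exact DifferentiableAt.comp (W₀, (0 : ℝ)) (hh i) hsnd
  have heml : DifferentiableAt ℝ (eml : (ι → Matrix (Fin 2) (Fin 2) ℂ) → Matrix (Fin 2) (Fin 2) ℂ)
      (fun i => if cen i then (1 : Matrix (Fin 2) (Fin 2) ℂ) else h ((W₀, (0 : ℝ)) : Matrix (Fin 2) (Fin 2) ℂ × ℝ).2 i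
        * star ((W₀, (0 : ℝ)) : Matrix (Fin 2) (Fin 2) ℂ × ℝ).1) :=
    ((analyticAt_eml hT₀).differentiableAt).restrictScalars ℝ
  exact (heml.comp (W₀, (0 : ℝ)) hT).mul differentiableAt_fst

/-- The slice `W ↦ eml(T_h(W))·W` (parameter frozen) is differentiable at `W₀` under the same polydisc condition. [folklore] -/
theorem differentiableAt_fibreCore (h : ι → Matrix (Fin 2) (Fin 2) ℂ) (W₀ : Matrix (Fin 2) (Fin 2) ℂ)
    (hT₀ : ∀ i, ‖(if cen i then (1 : Matrix (Fin 2) (Fin 2) ℂ) else h i * star W₀) - 1‖ < 1) :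
    DifferentiableAt ℝ (fun W : Matrix (Fin 2) (Fin 2) ℂ => eml (fun i => if cen i then (1 : Matrix (Fin 2) (Fin 2) ℂ) else h i * star W) * W) W₀ := by
  have hT : DifferentiableAt ℝ (fun W : Matrix (Fin 2) (Fin 2) ℂ => (fun i => if cen i then (1 : Matrix (Fin 2) (Fin 2) ℂ) else h i * star W)) W₀ := by
    refine differentiableAt_pi.mpr fun i => ?_
    split_ifs with hc
    · exact differentiableAt_const _
    · exact DifferentiableAt.mul (differentiableAt_const _) differentiableAt_id.star
  have heml : DifferentiableAt ℝ (eml : (ι → Matrix (Fin 2) (Fin 2) ℂ) → Matrix (Fin 2) (Fin 2) ℂ)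
      (fun i => if cen i then (1 : Matrix (Fin 2) (Fin 2) ℂ) else h i * star W₀) :=
    ((analyticAt_eml hT₀).differentiableAt).restrictScalars ℝ
  exact (heml.comp W₀ hT).mul differentiableAt_id

/-- **THE PARTIAL DERIVATIVE IN THE COORDINATE IS THE LINE DERIVATIVE**: with `A` the Fréchet derivative of `(W, t) ↦ eml(T_{h(t)}(W))·W` at `(W₀, 0)`,
`A(X, 0) = D eml(T₀)[(0 | h_i(0)X^*)]·W₀ + eml(T₀)·X`. [folklore] -/
theorem fderiv_fibreCore_param_inl (h : ℝ → ι → Matrix (Fin 2) (Fin 2) ℂ) (W₀ : Matrix (Fin 2) (Fin 2) ℂ)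
    (hh : ∀ i, DifferentiableAt ℝ (fun t : ℝ => h t i) 0)
    (hT₀ : ‖(fun i => if cen i then (1 : Matrix (Fin 2) (Fin 2) ℂ) else h 0 i * star W₀) - 1‖ < 1 / 3) (X : Matrix (Fin 2) (Fin 2) ℂ) :
    fderiv ℝ (fun p : Matrix (Fin 2) (Fin 2) ℂ × ℝ =>
        eml (fun i => if cen i then (1 : Matrix (Fin 2) (Fin 2) ℂ) else h p.2 i * star p.1) * p.1) (W₀, 0) (X, 0)
      = fderiv ℂ (eml : (ι → Matrix (Fin 2) (Fin 2) ℂ) → Matrix (Fin 2) (Fin 2) ℂ) (fun i => if cen i then (1 : Matrix (Fin 2) (Fin 2) ℂ) else h 0 i * star W₀)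
          (fun i => if cen i then (0 : Matrix (Fin 2) (Fin 2) ℂ) else h 0 i * star X) * W₀
        + eml (fun i => if cen i then (1 : Matrix (Fin 2) (Fin 2) ℂ) else h 0 i * star W₀) * X := by
  have hT₀' : ∀ i, ‖(if cen i then (1 : Matrix (Fin 2) (Fin 2) ℂ) else h 0 i * star W₀) - 1‖ < 1 := fun i => by
    have := (norm_le_pi_norm ((fun i => if cen i then (1 : Matrix (Fin 2) (Fin 2) ℂ) else h 0 i * star W₀) - 1) i).trans_lt hT₀
    rw [Pi.sub_apply, Pi.one_apply] at this
    linarith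
  set G : Matrix (Fin 2) (Fin 2) ℂ × ℝ → Matrix (Fin 2) (Fin 2) ℂ := fun p =>
    eml (fun i => if cen i then (1 : Matrix (Fin 2) (Fin 2) ℂ) else h p.2 i * star p.1) * p.1 with hG
  have hGd : HasFDerivAt G (fderiv ℝ G (W₀, 0)) (W₀, 0) := (differentiableAt_fibreCore_param cen h W₀ hh hT₀').hasFDerivAt
  -- the line `s ↦ (W₀ + sX, 0)` through `(W₀, 0)`
  have hline : HasDerivAt (fun s : ℝ => ((W₀ + (s : ℂ) • X, (0 : ℝ)) : Matrix (Fin 2) (Fin 2) ℂ × ℝ)) ((X, 0) : Matrix (Fin 2) (Fin 2) ℂ × ℝ) 0 := by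
    have h1 : HasDerivAt (fun s : ℝ => W₀ + (s : ℂ) • X) X 0 := by
      have := ((hasDerivAt_id (0 : ℝ)).ofReal_comp).smul_const X
      simpa using this.const_add W₀
    exact h1.prodMk (hasDerivAt_const (0 : ℝ) (0 : ℝ))
  have h0 : ((W₀, (0 : ℝ)) : Matrix (Fin 2) (Fin 2) ℂ × ℝ) = (W₀ + ((0 : ℝ) : ℂ) • X, 0) := by simp
  have hcomp := hGd.comp_hasDerivAt_of_eq (0 : ℝ) hline h0
  -- the same line derivative computed directly
  have hdirect := hasDerivAt_fibreCore_line cen (h 0) W₀ X hT₀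
  have heq : (G ∘ fun s : ℝ => ((W₀ + (s : ℂ) • X, (0 : ℝ)) : Matrix (Fin 2) (Fin 2) ℂ × ℝ))
      = fun s : ℝ => eml (fun i => if cen i then (1 : Matrix (Fin 2) (Fin 2) ℂ) else h 0 i * star (W₀ + (s : ℂ) • X)) * (W₀ + (s : ℂ) • X) := by
    funext s; simp only [hG, Function.comp_apply]
  rw [heq] at hcomp
  exact hcomp.unique hdirect

/-- **A BOUNDED LEFT INVERSE FROM A LOWER BOUND** (finite dimensions): a continuous linear endomorphism `A` of a finite-dimensional real normed space with
`c‖X‖ ≤ ‖AX‖`, `c > 0`, has a continuous linear left inverse. [folklore] -/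
theorem exists_leftInverse_of_bound {E : Type*} [NormedAddCommGroup E] [NormedSpace ℝ E] [FiniteDimensional ℝ E] (A : E →L[ℝ] E) {c : ℝ} (hc : 0 < c)
    (hA : ∀ X : E, c * ‖X‖ ≤ ‖A X‖) : ∃ B : E →L[ℝ] E, ∀ X : E, B (A X) = X := by
  have hinj : Function.Injective (A : E →ₗ[ℝ] E) := by
    rw [← LinearMap.ker_eq_bot, LinearMap.ker_eq_bot']
    intro X hX
    have h1 := hA X
    rw [show A X = 0 from hX, norm_zero] at h1
    have : ‖X‖ ≤ 0 := by nlinarith [norm_nonneg X]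
    exact norm_le_zero_iff.mp this
  set e : E ≃ₗ[ℝ] E := LinearEquiv.ofInjectiveEndo (A : E →ₗ[ℝ] E) hinj with he
  refine ⟨LinearMap.toContinuousLinearMap (e.symm : E →ₗ[ℝ] E), fun X => ?_⟩
  show e.symm (A X) = X
  have : e X = A X := rfl
  rw [← this, LinearEquiv.symm_apply_apply]

end FibreCore

end Summit.QuantumFields.YangMills.Theorems.Prop8Criticality

end
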